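import Summits.Ventures.PercRepro.S2TopCountCell

/-!
# PercRepro — S2: THE CELL THEOREM WITH THE THREE COUNTS PARAMETERS (p7, gen 12; sub-claim S2; the `p = 15` row)

The kit's level-`5` cell with its three counts — the top count `#U(p, 5) ≤ U`, the rank-`≤ 5` count `#{X ⊆ E : ρ(X) ≤ 5} ≤ A` and the
spanning count `#{X ⊆ E : ρ(X) = ρ(E)} ≤ S` — all PARAMETERS, and only the slack arithmetic left: `Φ ≤ 2^(p+5)/K`, a free slack `m/1024`,
`1024·U ≤ (1024 − m)·2^(d−5)·K` and `1024·(A + S) ≤ m·2^(p+d)` give `Φ·#U ≤ #Y` (`2^n ≤ #Y + #{ρ ≤ 5} + #{spanning}`,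
`Matroid.two_pow_le_midCount_add`). **`c025_core_five_cell_of_counts_xqictq5g`** and its RLS form **`c025_core_five_cell_of_counts_xqictq5`**.
S2TailCell's cell is this one with `A` = the kit's rank-`≤ 5` tail; the spread case of `(15, 7)` feeds `A` from S2SpreadTail (rank-`5` sets `≤ 8`
points, rank-`4` sets `≤ 7`) and `S` from the triangle trade-off on the bases. Axioms: standard.
-/

open scoped Matroid

namespace PercRepro

namespace ThmN

open Set

variable {α : Type}

/-- **The `e`-free core at level `5` from one cell with the three counts parameters** (`p`, `d` free; `hcell` = the polynomial side
`1024·U ≤ (1024 − m)·2^(d−5)·K` and the tail side `1024·(A + S) ≤ m·2^(p+d)` with a free slack `m/1024`). -/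
theorem c025_core_five_cell_of_counts_xqictq5g (M : Matroid α) [M.Finite] (p d : ℕ) (hd6 : 6 ≤ d)
    (hR : M.eRank = (p : ℕ∞)) (hn : M.E.ncard = p + d)
    (U : ℕ) (hU : Matroid.topCount M p 5 ≤ U)
    (A : ℚ) (hA : ({X : Set α | X ⊆ M.E ∧ M.eRk X ≤ 5}.ncard : ℚ) ≤ A)
    (S : ℕ) (hS : {X : Set α | X ⊆ M.E ∧ M.eRk X = M.eRank}.ncard ≤ S)
    (K : ℕ) (hK : 0 < K) (Φ : ℚ) (hΦ : Φ ≤ (2 : ℚ) ^ (p + 5) / (K : ℚ))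
    (hcell : ∃ m : ℕ, m ≤ 1024 ∧
      (1024 * (U : ℚ) ≤ ((1024 - m : ℕ) : ℚ) * 2 ^ (d - 5) * (K : ℚ)) ∧
      (1024 * (A + (S : ℚ)) ≤ (m : ℚ) * 2 ^ (p + d))) :
    Φ * (Matroid.topCount M p 5 : ℚ) ≤ (Matroid.midCount M p 5 : ℚ) := by
  classical
  have hslack : ∀ {Φ U Y A B V : ℚ} {m : ℕ},
      Φ ≤ (2 : ℚ) ^ (p + 5) / (K : ℚ) → 0 ≤ U → U ≤ V →
      (2 : ℚ) ^ (p + d) ≤ Y + A + B → m ≤ 1024 → (1024 : ℚ) * (A + B) ≤ (m : ℚ) * 2 ^ (p + d) →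
      (1024 : ℚ) * V ≤ ((1024 - m : ℕ) : ℚ) * 2 ^ (d - 5) * (K : ℚ) →
      Φ * U ≤ Y := by
    intro Φ U Y A B V m hΦ hU0 hU hY hmk hAB hpoly
    have hc : (0 : ℚ) < (K : ℚ) := by exact_mod_cast hK
    have hkq : (0 : ℚ) < (1024 : ℚ) := by norm_num
    have hkm : ((1024 - m : ℕ) : ℚ) = (1024 : ℚ) - (m : ℚ) := by
      rw [Nat.cast_sub hmk]; norm_num
    have hpow : (2 : ℚ) ^ (p + d) = 2 ^ (p + 5) * 2 ^ (d - 5) := by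
      rw [← pow_add]; congr 1; omega
    have h1 : Φ * U ≤ (2 : ℚ) ^ (p + 5) / (K : ℚ) * U := mul_le_mul_of_nonneg_right hΦ hU0
    have h2 : (2 : ℚ) ^ (p + 5) / (K : ℚ) * U ≤
        (2 : ℚ) ^ (p + 5) / (K : ℚ) * V :=
      mul_le_mul_of_nonneg_left hU (by positivity)
    have h3 : (2 : ℚ) ^ (p + 5) / (K : ℚ) * V ≤
        ((1024 : ℚ) - m) / 1024 * 2 ^ (p + d) := by
      rw [hpow, div_mul_eq_mul_div, div_le_iff₀ hc]
      have h2p : (0 : ℚ) < 2 ^ (p + 5) := by positivity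
      have hpoly' : V ≤
          ((1024 : ℚ) - m) / 1024 * 2 ^ (d - 5) * (K : ℚ) := by
        rw [hkm] at hpoly
        rw [div_mul_eq_mul_div, div_mul_eq_mul_div, div_eq_mul_inv]
        have := mul_le_mul_of_nonneg_right hpoly (le_of_lt (inv_pos.mpr hkq))
        rw [mul_comm (1024 : ℚ), mul_assoc, mul_inv_cancel₀ hkq.ne', mul_one] at this
        linarith
      calc (2 : ℚ) ^ (p + 5) * V
          ≤ 2 ^ (p + 5) * (((1024 : ℚ) - m) / 1024 * 2 ^ (d - 5) * (K : ℚ)) :=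
            mul_le_mul_of_nonneg_left hpoly' h2p.le
        _ = ((1024 : ℚ) - m) / 1024 * (2 ^ (p + 5) * 2 ^ (d - 5)) * (K : ℚ) := by ring
    have h4 : ((1024 : ℚ) - m) / 1024 * (2 : ℚ) ^ (p + d) ≤ Y := by
      have hAB' : A + B ≤ (m : ℚ) / 1024 * 2 ^ (p + d) := by
        rw [div_mul_eq_mul_div, le_div_iff₀ hkq]; linarith
      have : ((1024 : ℚ) - m) / 1024 * (2 : ℚ) ^ (p + d) = 2 ^ (p + d) - (m : ℚ) / 1024 * 2 ^ (p + d) := by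
        rw [sub_div, div_self hkq.ne']; ring
      rw [this]; linarith
    linarith
  have hEcard : M.ground_finite.toFinset.card = p + d := by
    rw [← Set.ncard_eq_toFinset_card _ M.ground_finite]; exact hn
  have hY := Matroid.two_pow_le_midCount_add (M := M) p 5 hR
  rw [hEcard] at hY
  have hYq : (2 : ℚ) ^ (p + d) ≤ (Matroid.midCount M p 5 : ℚ) +
      ({X : Set α | X ⊆ M.E ∧ M.eRk X ≤ 5}.ncard : ℚ) +
      ({X : Set α | X ⊆ M.E ∧ M.eRk X = M.eRank}.ncard : ℚ) := by exact_mod_cast hY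
  have hU0' : (0 : ℚ) ≤ (Matroid.topCount M p 5 : ℚ) := Nat.cast_nonneg _
  have hUq : (Matroid.topCount M p 5 : ℚ) ≤ (U : ℚ) := by exact_mod_cast hU
  have hBq : ({X : Set α | X ⊆ M.E ∧ M.eRk X = M.eRank}.ncard : ℚ) ≤ (S : ℚ) := by exact_mod_cast hS
  obtain ⟨m, hm, hpoly, htail⟩ := hcell
  have hABq : (1024 : ℚ) * (({X : Set α | X ⊆ M.E ∧ M.eRk X ≤ 5}.ncard : ℚ) +
      ({X : Set α | X ⊆ M.E ∧ M.eRk X = M.eRank}.ncard : ℚ)) ≤ (m : ℚ) * 2 ^ (p + d) := by linarith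
  exact hslack hΦ hU0' hUq hYq hm hABq hpoly

/-- **The RLS form** of `c025_core_five_cell_of_counts_xqictq5g` at `Φ = Φ(p, 5)`, `K = C(p + 5, 5)`. -/
theorem c025_core_five_cell_of_counts_xqictq5 (M : Matroid α) [M.Finite] (p d : ℕ) (hd6 : 6 ≤ d)
    (hR : M.eRank = (p : ℕ∞)) (hn : M.E.ncard = p + d)
    (U : ℕ) (hU : Matroid.topCount M p 5 ≤ U)
    (A : ℚ) (hA : ({X : Set α | X ⊆ M.E ∧ M.eRk X ≤ 5}.ncard : ℚ) ≤ A)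
    (S : ℕ) (hS : {X : Set α | X ⊆ M.E ∧ M.eRk X = M.eRank}.ncard ≤ S)
    (hcell : ∃ m : ℕ, m ≤ 1024 ∧
      (1024 * (U : ℚ) ≤ ((1024 - m : ℕ) : ℚ) * 2 ^ (d - 5) * ((p + 5).choose 5 : ℚ)) ∧
      (1024 * (A + (S : ℚ)) ≤ (m : ℚ) * 2 ^ (p + d))) :
    RLS M p 5 := by
  have hΦ := phiK_le_two_pow_div p 5
  rw [Nat.choose_symm_add] at hΦ
  rw [RLS_iff]
  exact c025_core_five_cell_of_counts_xqictq5g M p d hd6 hR hn U hU A hA S hS ((p + 5).choose 5)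
    (Nat.choose_pos (by omega)) (phiK p 5) hΦ hcell

end ThmN

end PercRepro
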